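import Summits.CriticalPhenomena.PercolationContinuityZ3.Theorems.PercNearOneGluingNoHeavyLowerTailKNGoodPocketBHKRestrict
import Mathlib.Combinatorics.SetFamily.FourFunctions
import HarnessLib

/-!
# `NoHeavyLowerTail` (stmt-CriticalPhenomena-4575) — the POCKET-AUGMENTED van den Berg–Häggström–Kahn
# inequality, III: THE THEOREM (induction on the vertex set) and its measure form

Support file (`--supports stmt-CriticalPhenomena-4575`, hull-port prover `prim-hp-2`, gen 21).  No named facts, no
sorries; standard axioms.  Third file of the series (`…KNGoodPocketBHKBase.lean`, `…KNGoodPocketBHKRestrict.lean`).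

THEOREM (pocket-augmented BHK 1.1).  `G` a finite weighted graph, `s, o` vertices, `X, Y` vertex sets, `H ≥ 0` an
increasing function of the open edge cluster `C_s`, `𝒬` ANY family of vertex sets disjoint from `Y`, and
`F := {o ↔ s} ∪ {C(o) ∈ 𝒬}` (`C(o)` the vertex set of the open cluster of `o`; `F` is NOT monotone).  Then
      `E[H(C_s) 1{s↮X}] · P(F, s↮Y) ≤ E[H(C_s) 1_F 1{s↮X∩Y}] · P(s↮X∪Y)`.
PROOF.  BHK's induction on the vertex set verbatim (`BHK2006.core`): condition on the set `S` of neighbours of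
`Z = X ∩ Y` joined to `Z` by an open edge, Ahlswede–Daykin (`four_functions_theorem_univ`), induction hypothesis on
`U ∖ Z` — using that given `S` the event `F` is the event of the same shape on `U ∖ Z` with the family
`{W ∈ 𝒬 : W ∩ S = ∅}`, antitone in `S` (`step_sumF`, file II) — and the NEW base case `KNGoodPocketBHK.base`
(file I: the pocket lemma "given `C(o) = W ∌ s` the rest is percolation on `G ∖ W`" plus Harris).

* `KNGoodPocketBHK.core2` — the theorem for percolation restricted to a vertex set `U` (finite sums).
* `KNGoodPocketBHK.pocketBHK` — measure form (`prodBernoulli w`), with `pocketAug s o 𝒬 = F`, `avoid s X = {s↮X}`.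
* `KNGoodPocketBHK.cov_pocketAug_nonneg` — `X = Y = T`: **given `{s ↮ T}`, `F` is positively correlated with
  every increasing function of `C_s`**: `(∫_D H(C_s)) · μ(F ∩ D) ≤ μ(D) · ∫_{F∩D} H(C_s)` (`D = {s↮T}`; for `𝒬 = ∅`
  this is BHK Thm. 1.3, while the pockets `{C(o) = W}` alone are negatively correlated with `C_s`);
  `KNGoodPocketBHK.real_pocketAug_inter_ge` — the same for an increasing event `A` determined by `C_s`.

APPLICATION (next files): with `s` a hub glued to two relays `a, b`, `T = {c}` and `A = {a ↔ b}` this is the B-side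
inequality (I) of the `|A| = 3` goodness reduction R3 (prim-hp-2 MEMO-gen12 §6):
`P(S_o = {c} | d) − P(S_o = {c} | [ab]) ≥ Σ_W (P(C(o)=W | [ab]) − P(C(o)=W | d))⁺`; all eight inequalities of
Conjecture B3 follow from its three instances (MEMO-gen21), hence universal goodness of every separated
Kozma–Nitzan quadruple with three relays.
[cite: VandenbergHaggstromKahn2005, Thm. 1.1 (pp. 3–5), Thm. 1.3 (p. 6)] [cite: KozmaNitzan2024, §3.2 (p. 12)]
-/

noncomputable section

namespace Summit.CriticalPhenomena.PercolationContinuityZ3.Theorems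

open MeasureTheory Set Literature.Probability.LatticeModels Literature.Probability.Percolation
open Literature.Probability.Percolation.BHK2006
open DecisionTree (ind ind_of_mem ind_of_not_mem ind_nonneg)
open scoped Classical

namespace KNGoodPocketBHK

variable {V : Type*}

/-! ### The pocket-augmented Theorem 1.1 by induction on the vertex set -/

section Core

variable [Fintype V] 

/-- **THEOREM (pocket-augmented BHK 1.1), functional form, percolation restricted to `U`.**  For `s ∈ U`,
`X, Y ⊆ U`, `H ≥ 0` increasing, and ANY family `𝒬` of vertex sets disjoint from `Y`, with
`F = {o ↔ s} ∪ {C(o) ∈ 𝒬}`: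
`E[H(C_s) 1{s↮X}] · P(F, s↮Y) ≤ E[H(C_s) 1_F 1{s ↮ X∩Y}] · P(s ↮ X∪Y)`.
Proof: strong induction on `U` following BHK pp. 3–5, with `base` in place of the two Harris applications.
[cite: VandenbergHaggstromKahn2005, Thm. 1.1 (pp. 3–5)] -/
theorem core2 (w : Sym2 V → ℝ) (hw0 : ∀ e, 0 ≤ w e) (hw1 : ∀ e, w e ≤ 1)
    (hm : ∑ ω, weight w ω = 1) (U : Finset V) :
    ∀ (s : V), s ∈ U → ∀ (o : V) (X Y : Set V), X ⊆ ↑U → Y ⊆ ↑U →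
    ∀ (Q : Set (Set V)), (∀ W ∈ Q, Disjoint W Y) →
    ∀ (H : Set (Sym2 V) → ℝ), Monotone H → (∀ a, 0 ≤ H a) →
    (∑ ω, weight w ω * (H (rC U s ω) * ind (rD U s X) ω)) *
      (∑ ω, weight w ω * (ind (fEv U s o Q) ω * ind (rD U s Y) ω)) ≤
    (∑ ω, weight w ω * (H (rC U s ω) * ind (fEv U s o Q) ω * ind (rD U s (X ∩ Y)) ω)) *
      (∑ ω, weight w ω * ind (rD U s (X ∪ Y)) ω) := by
  induction U using Finset.strongInduction with
  | H U ih =>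
  intro s hsU o X Y hXU hYU Q hQ H hH hH0
  have hRHS : 0 ≤ (∑ ω, weight w ω * (H (rC U s ω) * ind (fEv U s o Q) ω * ind (rD U s (X ∩ Y)) ω)) *
      (∑ ω, weight w ω * ind (rD U s (X ∪ Y)) ω) :=
    mul_nonneg (Finset.sum_nonneg fun ω _ => mul_nonneg (weight_nonneg hw0 hw1 ω)
      (mul_nonneg (mul_nonneg (hH0 _) (ind_nonneg _ _)) (ind_nonneg _ _)))
      (Finset.sum_nonneg fun ω _ => mul_nonneg (weight_nonneg hw0 hw1 ω) (ind_nonneg _ _))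
  -- trivial cases `s ∈ X`, `s ∈ Y`
  by_cases hsX : s ∈ X
  · have h0 : ∑ ω, weight w ω * (H (rC U s ω) * ind (rD U s X) ω) = 0 :=
      Finset.sum_eq_zero fun ω _ => by
        rw [rD_eq_empty hsX, ind_of_not_mem (Set.notMem_empty ω)]; ring
    rw [h0, zero_mul]; exact hRHS
  by_cases hsY : s ∈ Y
  · have h0 : ∑ ω, weight w ω * (ind (fEv U s o Q) ω * ind (rD U s Y) ω) = 0 :=
      Finset.sum_eq_zero fun ω _ => by
        rw [rD_eq_empty hsY, ind_of_not_mem (Set.notMem_empty ω)]; ring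
    rw [h0, mul_zero]; exact hRHS
  -- `Z := X ∩ Y`
  set Z : Finset V := U.filter fun v => v ∈ X ∧ v ∈ Y with hZ
  have hZU : Z ⊆ U := Finset.filter_subset _ _
  have hmemZ : ∀ v, v ∈ Z ↔ v ∈ X ∧ v ∈ Y := fun v => by
    simp only [hZ, Finset.mem_filter, and_iff_right_iff_imp]
    exact fun h => hXU h.1
  have hsZ : s ∉ Z := fun h => hsX ((hmemZ s).1 h).1
  have hQZ : ∀ W ∈ Q, Disjoint W ↑Z := fun W hW =>
    (hQ W hW).mono_right fun v hv => ((hmemZ v).1 (Finset.mem_coe.1 hv)).2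
  rcases Z.eq_empty_or_nonempty with hZe | hZne
  · /- `X ∩ Y = ∅`: the base case (pocket-Harris + Harris). -/
    have hXY : ∀ ω, ind (rD U s (X ∩ Y)) ω = 1 := fun ω =>
      ind_of_mem fun x hx _ => by
        have : x ∈ Z := (hmemZ x).2 hx
        rw [hZe] at this
        exact absurd this (Finset.notMem_empty x)
    have hXuY : ∀ ω, ind (rD U s (X ∪ Y)) ω = ind (rD U s X) ω * ind (rD U s Y) ω := fun ω => by
      rw [rD_union, ind_inter]
    simp_rw [hXY, mul_one, hXuY]
    exact base hw0 hw1 hm U s o X Y Q hH hH0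
  · /- `Z ≠ ∅`: condition on `S` and apply the four functions theorem with the induction hypothesis on `U ∖ Z`. -/
    have hss : U \ Z ⊂ U := Finset.sdiff_ssubset hZU hZne
    have hsU' : s ∈ U \ Z := Finset.mem_sdiff.2 ⟨hsU, hsZ⟩
    have hZX : (↑Z : Set V) ⊆ X := fun v hv => ((hmemZ v).1 hv).1
    have hZY : (↑Z : Set V) ⊆ Y := fun v hv => ((hmemZ v).1 hv).2
    have hZXY : (↑Z : Set V) ⊆ X ∩ Y := fun v hv => (hmemZ v).1 hv
    have hZXuY : (↑Z : Set V) ⊆ X ∪ Y := fun v hv => Or.inl (((hmemZ v).1 hv).1)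
    -- the four sums, conditioned on `S`
    have e1 := step_sum hZU hsZ hZX w hm H
    have e2 : ∑ ω, weight w ω * (ind (fEv U s o Q) ω * ind (rD U s Y) ω) =
        ∑ ω, weight w ω * blockF w (U \ Z) s o (fun _ => 1) Q (Y \ ↑Z) (rS U Z ω) := by
      have := step_sumF hZU hsZ hZY w hm (fun _ => 1) hQZ (o := o)
      simp only [one_mul] at this
      simpa only [blockF, one_mul] using this
    have e3 := step_sumF hZU hsZ hZXY w hm H hQZ (o := o)
    have e4 : ∑ ω, weight w ω * ind (rD U s (X ∪ Y)) ω =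
        ∑ ω, weight w ω * blockE w (U \ Z) s (fun _ => 1) ((X ∪ Y) \ ↑Z) (rS U Z ω) := by
      have := step_sum hZU hsZ hZXuY w hm (fun _ => 1)
      simpa only [one_mul] using this
    rw [e1, e2, e3, e4]
    refine four_functions_theorem_univ
      (fun ω => weight w ω * blockE w (U \ Z) s H (X \ ↑Z) (rS U Z ω))
      (fun ω => weight w ω * blockF w (U \ Z) s o (fun _ => 1) Q (Y \ ↑Z) (rS U Z ω))
      (fun ω => weight w ω * blockF w (U \ Z) s o H Q ((X ∩ Y) \ ↑Z) (rS U Z ω))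
      (fun ω => weight w ω * blockE w (U \ Z) s (fun _ => 1) ((X ∪ Y) \ ↑Z) (rS U Z ω))
      (fun ω => mul_nonneg (weight_nonneg hw0 hw1 ω) (blockE_nonneg hw0 hw1 _ _ hH0 _ _))
      (fun ω => mul_nonneg (weight_nonneg hw0 hw1 ω) (blockF_nonneg hw0 hw1 _ _ _ (fun _ => zero_le_one) _ _ _))
      (fun ω => mul_nonneg (weight_nonneg hw0 hw1 ω) (blockF_nonneg hw0 hw1 _ _ _ hH0 _ _ _))
      (fun ω => mul_nonneg (weight_nonneg hw0 hw1 ω)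
        (blockE_nonneg hw0 hw1 _ _ (fun _ => zero_le_one) _ _))
      fun a b => ?_
    -- the Ahlswede–Daykin hypothesis: weight lattice identity × induction hypothesis
    set Sa := rS U Z a with hSa
    set Sb := rS U Z b with hSb
    have hSaU : Sa ⊆ ↑(U \ Z) := rS_subset U Z a
    have hSbU : Sb ⊆ ↑(U \ Z) := rS_subset U Z b
    have hX1 : X \ ↑Z ∪ Sa ⊆ ↑(U \ Z) := Set.union_subset
      (fun v hv => by rw [Finset.coe_sdiff]; exact ⟨hXU hv.1, hv.2⟩) hSaU
    have hY1 : Y \ ↑Z ∪ Sb ⊆ ↑(U \ Z) := Set.union_subset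
      (fun v hv => by rw [Finset.coe_sdiff]; exact ⟨hYU hv.1, hv.2⟩) hSbU
    have hQ1 : ∀ W ∈ qRestr Q Sb, Disjoint W (Y \ ↑Z ∪ Sb) := fun W hW =>
      Set.disjoint_union_right.2 ⟨(hQ W hW.1).mono_right fun _ hv => hv.1, hW.2⟩
    have IH := ih (U \ Z) hss s hsU' o (X \ ↑Z ∪ Sa) (Y \ ↑Z ∪ Sb) hX1 hY1 (qRestr Q Sb) hQ1 H hH hH0
    -- monotonicity in the conditioning sets
    have hsub3 : (X ∩ Y) \ ↑Z ∪ rS U Z (a ∩ b) ⊆ (X \ ↑Z ∪ Sa) ∩ (Y \ ↑Z ∪ Sb) := by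
      refine Set.union_subset (fun v hv => ⟨Or.inl ⟨hv.1.1, hv.2⟩, Or.inl ⟨hv.1.2, hv.2⟩⟩) ?_
      exact fun v hv =>
        ⟨Or.inr (rS_inter_subset U Z a b hv).1, Or.inr (rS_inter_subset U Z a b hv).2⟩
    have hsub4 : (X ∪ Y) \ ↑Z ∪ rS U Z (a ∪ b) ⊆ (X \ ↑Z ∪ Sa) ∪ (Y \ ↑Z ∪ Sb) := by
      rw [rS_union]
      rintro v (⟨hXY | hXY, hvZ⟩ | hS | hS)
      · exact Or.inl (Or.inl ⟨hXY, hvZ⟩)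
      · exact Or.inr (Or.inl ⟨hXY, hvZ⟩)
      · exact Or.inl (Or.inr hS)
      · exact Or.inr (Or.inr hS)
    have hQab : qRestr Q Sb ⊆ qRestr Q (rS U Z (a ∩ b)) :=
      qRestr_mono fun v hv => (rS_inter_subset U Z a b hv).2
    have h3 : ∑ ω, weight w ω * (H (rC (U \ Z) s ω) * ind (fEv (U \ Z) s o (qRestr Q Sb)) ω *
        ind (rD (U \ Z) s ((X \ ↑Z ∪ Sa) ∩ (Y \ ↑Z ∪ Sb))) ω) ≤
        blockF w (U \ Z) s o H Q ((X ∩ Y) \ ↑Z) (rS U Z (a ∩ b)) :=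
      Finset.sum_le_sum fun ω _ => mul_le_mul_of_nonneg_left
        (mul_le_mul (mul_le_mul_of_nonneg_left (ind_mono (fEv_mono hQab) ω) (hH0 _))
          (ind_mono (rD_antitone hsub3) ω) (ind_nonneg _ _) (mul_nonneg (hH0 _) (ind_nonneg _ _)))
        (weight_nonneg hw0 hw1 ω)
    have h4 : ∑ ω, weight w ω * ind (rD (U \ Z) s ((X \ ↑Z ∪ Sa) ∪ (Y \ ↑Z ∪ Sb))) ω ≤
        blockE w (U \ Z) s (fun _ => 1) ((X ∪ Y) \ ↑Z) (rS U Z (a ∪ b)) := by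
      have := sum_ind_mono hw0 hw1 (h := fun _ => (1 : ℝ)) (fun _ => zero_le_one)
        (rD_antitone (U := U \ Z) (s := s) hsub4) (w := w)
      simp only [one_mul] at this
      simpa only [blockE, one_mul] using this
    have hn3 : 0 ≤ ∑ ω, weight w ω * (H (rC (U \ Z) s ω) * ind (fEv (U \ Z) s o (qRestr Q Sb)) ω *
        ind (rD (U \ Z) s ((X \ ↑Z ∪ Sa) ∩ (Y \ ↑Z ∪ Sb))) ω) :=
      Finset.sum_nonneg fun ω _ => mul_nonneg (weight_nonneg hw0 hw1 ω)
        (mul_nonneg (mul_nonneg (hH0 _) (ind_nonneg _ _)) (ind_nonneg _ _))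
    have eSb : blockF w (U \ Z) s o (fun _ => 1) Q (Y \ ↑Z) Sb =
        ∑ ω, weight w ω * (ind (fEv (U \ Z) s o (qRestr Q Sb)) ω * ind (rD (U \ Z) s (Y \ ↑Z ∪ Sb)) ω) := by
      simp only [blockF, one_mul]
    have hIH' : blockE w (U \ Z) s H (X \ ↑Z) Sa * blockF w (U \ Z) s o (fun _ => 1) Q (Y \ ↑Z) Sb ≤
        blockF w (U \ Z) s o H Q ((X ∩ Y) \ ↑Z) (rS U Z (a ∩ b)) *
          blockE w (U \ Z) s (fun _ => 1) ((X ∪ Y) \ ↑Z) (rS U Z (a ∪ b)) := by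
      rw [eSb]
      exact IH.trans (mul_le_mul h3 h4 (Finset.sum_nonneg fun ω _ =>
        mul_nonneg (weight_nonneg hw0 hw1 ω) (ind_nonneg _ _))
        (blockF_nonneg hw0 hw1 _ _ _ hH0 _ _ _))
    have hwab := weight_inter_mul_union w a b
    show weight w a * blockE w (U \ Z) s H (X \ ↑Z) Sa *
        (weight w b * blockF w (U \ Z) s o (fun _ => 1) Q (Y \ ↑Z) Sb) ≤
      weight w (a ∩ b) * blockF w (U \ Z) s o H Q ((X ∩ Y) \ ↑Z) (rS U Z (a ∩ b)) *
        (weight w (a ∪ b) * blockE w (U \ Z) s (fun _ => 1) ((X ∪ Y) \ ↑Z) (rS U Z (a ∪ b)))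
    calc weight w a * blockE w (U \ Z) s H (X \ ↑Z) Sa *
          (weight w b * blockF w (U \ Z) s o (fun _ => 1) Q (Y \ ↑Z) Sb)
        = (weight w a * weight w b) *
          (blockE w (U \ Z) s H (X \ ↑Z) Sa * blockF w (U \ Z) s o (fun _ => 1) Q (Y \ ↑Z) Sb) := by ring
      _ ≤ (weight w (a ∩ b) * weight w (a ∪ b)) *
          (blockF w (U \ Z) s o H Q ((X ∩ Y) \ ↑Z) (rS U Z (a ∩ b)) *
            blockE w (U \ Z) s (fun _ => 1) ((X ∪ Y) \ ↑Z) (rS U Z (a ∪ b))) := by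
          rw [hwab]
          exact mul_le_mul_of_nonneg_left hIH'
            (mul_nonneg (weight_nonneg hw0 hw1 _) (weight_nonneg hw0 hw1 _))
      _ = _ := by ring

end Core


/-! ### Measure form on the whole graph -/

section MeasureForm

variable [Fintype V]

/-- The pocket-augmented event `F = {o ↔ s} ∪ {C(o) ∈ 𝒬}` of bond percolation (`C(o) = openCluster ω o`, the
vertex set of the open cluster of `o`). [cite: KozmaNitzan2024, §3.2 p. 12 (the events `C(0) = W`)] -/
def pocketAug (s o : V) (Q : Set (Set V)) : Set (BondConfig V) :=
  {ω | (openGraph ω).Reachable o s ∨ openCluster ω o ∈ Q}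

/-- BHK's event `R_X = {s ↮ X}`. [cite: VandenbergHaggstromKahn2005, §1 p. 3] -/
def avoid (s : V) (X : Set V) : Set (BondConfig V) := {ω | ∀ x ∈ X, ¬ (openGraph ω).Reachable s x}

omit [Fintype V] in
/-- `avoid s (X ∪ Y) = avoid s X ∩ avoid s Y`. [folklore] -/
theorem avoid_union (s : V) (X Y : Set V) : avoid s (X ∪ Y) = avoid s X ∩ avoid s Y := by
  ext ω
  simp only [avoid, Set.mem_setOf_eq, Set.mem_inter_iff, Set.mem_union, or_imp, forall_and]

/-- **THEOREM (pocket-augmented BHK 1.1), measure form.**  For bond percolation `μ = prodBernoulli w` on a finite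
graph, vertices `s, o`, vertex sets `X, Y`, an increasing `H ≥ 0` of the open edge cluster `C_s`, and ANY family `𝒬`
of vertex sets disjoint from `Y`, with `F = {o ↔ s} ∪ {C(o) ∈ 𝒬}`:
`(∫_{s↮X} H(C_s)) · μ(F ∩ {s↮Y}) ≤ (∫_{F ∩ {s↮X∩Y}} H(C_s)) · μ{s ↮ X∪Y}`.
[cite: VandenbergHaggstromKahn2005, Thm. 1.1 (pp. 3–5)] [cite: KozmaNitzan2024, §3.2 p. 12] -/
theorem pocketBHK (w : Sym2 V → unitInterval) (s o : V) (X Y : Set V) (Q : Set (Set V))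
    (hQ : ∀ W ∈ Q, Disjoint W Y) (H : Set (Sym2 V) → ℝ) (hH : Monotone H) (hH0 : ∀ a, 0 ≤ H a) :
    (∫ ω in avoid s X, H (openEdgeCluster ω s) ∂(prodBernoulli w)) *
        (prodBernoulli w).real (pocketAug s o Q ∩ avoid s Y) ≤
      (∫ ω in pocketAug s o Q ∩ avoid s (X ∩ Y), H (openEdgeCluster ω s) ∂(prodBernoulli w)) *
        (prodBernoulli w).real (avoid s (X ∪ Y)) := by
  classical
  set w' : Sym2 V → ℝ := fun e => (w e : ℝ) with hw'
  have hw0 : ∀ e, 0 ≤ w' e := fun e => (w e).2.1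
  have hw1 : ∀ e, w' e ≤ 1 := fun e => (w e).2.2
  -- integrals and measures as finite sums
  have hint : ∀ (D : Set (BondConfig V)) (h : Set (Sym2 V) → ℝ),
      ∫ ω in D, h ω ∂(prodBernoulli w) = ∑ ω, weight w' ω * (h ω * ind D ω) := by
    intro D h
    rw [← integral_indicator MeasurableSet.of_discrete, integral_prodBernoulli_eq_sum]
    refine Finset.sum_congr rfl fun ω _ => ?_
    by_cases hω : ω ∈ D
    · rw [Set.indicator_of_mem hω, ind_of_mem hω, mul_one]
    · rw [Set.indicator_of_notMem hω, ind_of_not_mem hω]; ring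
  have hreal : ∀ D : Set (BondConfig V), (prodBernoulli w).real D = ∑ ω, weight w' ω * ind D ω := by
    intro D
    rw [← integral_indicator_one MeasurableSet.of_discrete, integral_prodBernoulli_eq_sum]
    refine Finset.sum_congr rfl fun ω _ => ?_
    by_cases hω : ω ∈ D
    · rw [Set.indicator_of_mem hω, ind_of_mem hω, Pi.one_apply]
    · rw [Set.indicator_of_notMem hω, ind_of_not_mem hω, mul_zero]
  have hm : ∑ ω, weight w' ω = 1 := by
    have h1 := integral_prodBernoulli_eq_sum w fun _ => (1 : ℝ)
    simp only [integral_const, probReal_univ, smul_eq_mul, mul_one] at h1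
    exact h1.symm
  -- `U = univ`: the restricted quantities are the original ones
  have hE : ∀ ω : Set (Sym2 V), ω ∩ BHK2006.edgesIn (Finset.univ : Finset V) = ω := fun ω => by
    ext e
    simp only [Set.mem_inter_iff, BHK2006.edgesIn, Set.mem_setOf_eq, Finset.mem_univ, imp_true_iff, and_true]
  have hC : ∀ ω, rC Finset.univ s ω = openEdgeCluster ω s := fun ω => by simp only [rC, hE]
  have hD : ∀ Z : Set V, rD Finset.univ s Z = avoid s Z := fun Z => by
    ext ω; simp only [rD, hE, avoid, Set.mem_setOf_eq]
  have hF : fEv Finset.univ s o Q = pocketAug s o Q := by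
    ext ω; simp only [fEv, oV, hE, pocketAug, openCluster, Set.mem_setOf_eq]
  have key := core2 w' hw0 hw1 hm Finset.univ s (Finset.mem_univ s) o X Y (by simp) (by simp) Q hQ H hH hH0
  simp only [hC, hD, hF] at key
  rw [hint, hreal, hint, hreal]
  have e1 : ∀ ω, ind (pocketAug s o Q ∩ avoid s Y) ω = ind (pocketAug s o Q) ω * ind (avoid s Y) ω :=
    fun ω => ind_inter _ _ ω
  have e2 : ∀ ω, H (openEdgeCluster ω s) * ind (pocketAug s o Q ∩ avoid s (X ∩ Y)) ω =
      H (openEdgeCluster ω s) * ind (pocketAug s o Q) ω * ind (avoid s (X ∩ Y)) ω := fun ω => by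
    rw [ind_inter]; ring
  simp_rw [e1, e2]
  exact key

/-- **COROLLARY (conditional positive correlation of the pocket-augmented event).**  Given `{s ↮ T}`, the event
`F = {o ↔ s} ∪ {C(o) ∈ 𝒬}` (ANY family `𝒬` of vertex sets disjoint from `T`) is positively correlated with every
increasing function `H` of the open edge cluster of `s`:
`(∫_D H(C_s)) · μ(F ∩ D) ≤ μ(D) · ∫_{F∩D} H(C_s)`,  `D = {s ↮ T}`.
For `𝒬 = ∅` this is BHK's Theorem 1.3; the pockets `{C(o) = W}` alone are NOT positively correlated with `C_s`.
With `s` a hub of the relays `a, b`, `T = {c}` and `H = 1{a ↔ b}` it is inequality (I) of the `|A| = 3` goodness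
reduction (prim-hp-2 MEMO-gen12 §6 / MEMO-gen21).
[cite: VandenbergHaggstromKahn2005, Thm. 1.3 (p. 6)] [cite: KozmaNitzan2024, §3.2 p. 12] -/
theorem cov_pocketAug_nonneg (w : Sym2 V → unitInterval) (s o : V) (T : Set V) (Q : Set (Set V))
    (hQ : ∀ W ∈ Q, Disjoint W T) (H : Set (Sym2 V) → ℝ) (hH : Monotone H) :
    (∫ ω in avoid s T, H (openEdgeCluster ω s) ∂(prodBernoulli w)) *
        (prodBernoulli w).real (pocketAug s o Q ∩ avoid s T) ≤
      (prodBernoulli w).real (avoid s T) *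
        ∫ ω in pocketAug s o Q ∩ avoid s T, H (openEdgeCluster ω s) ∂(prodBernoulli w) := by
  -- shift `H` to be nonnegative (`H ∅ ≤ H` on a finite edge set), apply `pocketBHK` with `X = Y = T`
  have key := pocketBHK w s o T T Q hQ (fun a => H a - H ∅) (fun a b hab => sub_le_sub_right (hH hab) _)
    (fun a => sub_nonneg.2 (hH (Set.empty_subset a)))
  rw [Set.inter_self, Set.union_self] at key
  have hFm : MeasurableSet (pocketAug s o Q ∩ avoid s T) := MeasurableSet.of_discrete
  have hDm : MeasurableSet (avoid s T) := MeasurableSet.of_discrete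
  have i1 : ∫ ω in avoid s T, (H (openEdgeCluster ω s) - H ∅) ∂(prodBernoulli w) =
      (∫ ω in avoid s T, H (openEdgeCluster ω s) ∂(prodBernoulli w)) - H ∅ * (prodBernoulli w).real (avoid s T) := by
    rw [integral_sub (Integrable.of_finite) (Integrable.of_finite), setIntegral_const, smul_eq_mul, mul_comm]
  have i2 : ∫ ω in pocketAug s o Q ∩ avoid s T, (H (openEdgeCluster ω s) - H ∅) ∂(prodBernoulli w) =
      (∫ ω in pocketAug s o Q ∩ avoid s T, H (openEdgeCluster ω s) ∂(prodBernoulli w)) -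
        H ∅ * (prodBernoulli w).real (pocketAug s o Q ∩ avoid s T) := by
    rw [integral_sub (Integrable.of_finite) (Integrable.of_finite), setIntegral_const, smul_eq_mul, mul_comm]
  rw [i1, i2] at key
  nlinarith [key]

/-- **Event form**: for an increasing event `A` determined by the open edge cluster of `s`
(`ω ∈ A`, `C_s(ω) ⊆ C_s(ω')` ⟹ `ω' ∈ A`), `μ(A ∩ D) · μ(F ∩ D) ≤ μ(D) · μ(A ∩ F ∩ D)`, `D = {s ↮ T}`.
[cite: VandenbergHaggstromKahn2005, Thm. 1.2 (p. 5)] [cite: KozmaNitzan2024, §3.2 p. 12] -/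
theorem real_pocketAug_inter_ge (w : Sym2 V → unitInterval) (s o : V) (T : Set V) (Q : Set (Set V))
    (hQ : ∀ W ∈ Q, Disjoint W T) (A : Set (BondConfig V))
    (hA : ∀ ω ω', ω ∈ A → openEdgeCluster ω s ⊆ openEdgeCluster ω' s → ω' ∈ A) :
    (prodBernoulli w).real (A ∩ avoid s T) * (prodBernoulli w).real (pocketAug s o Q ∩ avoid s T) ≤
      (prodBernoulli w).real (avoid s T) * (prodBernoulli w).real (A ∩ (pocketAug s o Q ∩ avoid s T)) := by
  classical
  -- `1_A = H ∘ C_s` with `H(C) = 1{∃ ω ∈ A, C_s(ω) ⊆ C}` monotone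
  set H : Set (Sym2 V) → ℝ := fun C => if ∃ ω ∈ A, openEdgeCluster ω s ⊆ C then 1 else 0 with hHdef
  have hH : Monotone H := by
    intro C C' hCC'
    simp only [hHdef]
    by_cases h : ∃ ω ∈ A, openEdgeCluster ω s ⊆ C
    · obtain ⟨ω, hω, hsub⟩ := h
      rw [if_pos ⟨ω, hω, hsub⟩, if_pos ⟨ω, hω, hsub.trans hCC'⟩]
    · rw [if_neg h]; split_ifs <;> norm_num
  have hHA : ∀ ω, H (openEdgeCluster ω s) = (A.indicator 1 : BondConfig V → ℝ) ω := by
    intro ω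
    by_cases hω : ω ∈ A
    · rw [Set.indicator_of_mem hω, Pi.one_apply]; exact if_pos ⟨ω, hω, subset_rfl⟩
    · rw [Set.indicator_of_notMem hω]
      exact if_neg fun ⟨ω', hω', hsub⟩ => hω (hA ω' ω hω' hsub)
  have key := cov_pocketAug_nonneg w s o T Q hQ H hH
  simp_rw [hHA] at key
  rwa [integral_indicator_one MeasurableSet.of_discrete, integral_indicator_one MeasurableSet.of_discrete,
    measureReal_restrict_apply MeasurableSet.of_discrete, measureReal_restrict_apply MeasurableSet.of_discrete] at key

end MeasureForm

end KNGoodPocketBHK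

end Summit.CriticalPhenomena.PercolationContinuityZ3.Theorems
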